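import Summits.Ventures.Crystal3D.TopCut.CapD12u59Agg1

/-!
# Cap cut `CapD12u59` (u₀ = -59/100, degree 12): kernel validation of Gram blocks E1, E2, E3, E4 (chunk theorems okE1_1, okE2_1, okE3_1, okE4_1; cost proxy 0.48 Gbit)

HONEST FRAMING: generated data / kernel-validation file of the venture `Crystal3D` (cell `pub-crystal3d`, phase 2,
seat p2): one piece of the kernel replay of an EXACT Bachoc–Vallentin CAP certificate on `S²` ([BachocVallentin2009]
Theorem 4.4, n = 3; cap level u₀ = -59/100, inner products ≤ 1/2, degree d = 12) solved directly in sum-of-squares form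
(`capfull.py`: CLARABEL float solve → exact rounding → integer identities; certificate `d12_u59over100`, bound value
11.985342 < 12) and checked through `TopCut/CapSOSCheck.lean` + `CapSOSSound.lean` (generic checker + soundness) and the tree's
`ThreePointCert.CheckKron` (Kronecker-packed Gram chunk validation). Nothing geometric is proved in this file; plain lists of
integers / rationals / monomials and `decide +kernel` facts about them (standard axioms only, no `native_decide`).
-/

namespace Summit.Ventures.Crystal3D.TopCut.CapD12u59

open Literature.Geometry.DiscreteGeometry Literature.Geometry.DiscreteGeometry.PolyCert PolyCert.SPoly
open Literature.Geometry.DiscreteGeometry.BachocVallentin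
open Summit.Ventures.PackingBounds.ThreePointCert Summit.Ventures.Crystal3D.CapSOS

set_option maxRecDepth 100000 in
set_option maxHeartbeats 0 in
/-- Block `E1`: rows from 0 (CapD12u59.gE1K.z.length rows) of `zᵀ(LLᵀ)z` added to `[]` give `eE1` (kernel, Kronecker-packed chunk check). [folklore] -/
theorem okE1_1 : chunkOKK CapD12u59.gE1K 0 CapD12u59.gE1K.z.length [] CapD12u59.eE1 = true := by
  decide +kernel

set_option maxRecDepth 100000 in
set_option maxHeartbeats 0 in
/-- Block `E2`: rows from 0 (CapD12u59.gE2K.z.length rows) of `zᵀ(LLᵀ)z` added to `[]` give `eE2` (kernel, Kronecker-packed chunk check). [folklore] -/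
theorem okE2_1 : chunkOKK CapD12u59.gE2K 0 CapD12u59.gE2K.z.length [] CapD12u59.eE2 = true := by
  decide +kernel

set_option maxRecDepth 100000 in
set_option maxHeartbeats 0 in
/-- Block `E3`: rows from 0 (CapD12u59.gE3K.z.length rows) of `zᵀ(LLᵀ)z` added to `[]` give `eE3` (kernel, Kronecker-packed chunk check). [folklore] -/
theorem okE3_1 : chunkOKK CapD12u59.gE3K 0 CapD12u59.gE3K.z.length [] CapD12u59.eE3 = true := by
  decide +kernel

set_option maxRecDepth 100000 in
set_option maxHeartbeats 0 in
/-- Block `E4`: rows from 0 (CapD12u59.gE4K.z.length rows) of `zᵀ(LLᵀ)z` added to `[]` give `eE4` (kernel, Kronecker-packed chunk check). [folklore] -/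
theorem okE4_1 : chunkOKK CapD12u59.gE4K 0 CapD12u59.gE4K.z.length [] CapD12u59.eE4 = true := by
  decide +kernel

end Summit.Ventures.Crystal3D.TopCut.CapD12u59
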